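/-
Copyright (c) 2026. All rights reserved.
Released under Apache 2.0 license as described in the file LICENSE.
-/
import Literature.Probability.FitznerVanDerHofstad2017.NobleBoundsNMidECut
import Literature.Probability.FitznerVanDerHofstad2017.NobleBlocksNTPrime
import HarnessLib

/-!
# Fitzner–van der Hofstad (2017), §6.1 (6.4) / (5.4) / App. B Table `B^{(2),ι,a,b}`: a middle junction, variant `F″` PROPER (`t ≠ y`, `z ≠ t`), inner class `2` — the rows `(0, ≥2 | d ≥ 2)` and `(≥2, ≥2 | d ≥ 2)` of term 3

[FvdH17] = R. Fitzner, R. van der Hofstad, *Mean-field behavior for nearest-neighbor percolation in `d > 10`*,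
arXiv:1506.07977v2 (EJP 22 (2017), paper 43).  Page numbers refer to the arXiv version.

Continuation of `NobleBoundsNMidECut` (variant `F″`, cut-through sub-regime).  Here the upper level `k + 1` of
a middle junction `k = i₀ + 1` is of kind `midE` with `t_k ≠ u_{k+1}` (`F″`, (4.58), p. 41) and a GENUINE last
sausage of inner class `2` (`t_k ≠ z_k`, the bond `{t_k, z_k}` — if it is one — closed): all six lines of level
`k + 1` are non-trivial — `b̄_k → w_{k+1}` (E₁), `w_{k+1} → t_k` (E₂, `≥ 1`), `t_k ←≥2→ z_k` (Z₁), `t_k → u_{k+1}`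
(X), `z_k → u_{k+1}` (Z₂) — plus the bond `b_k` and the exit line `w_k → z_k` of level `k`; exit class above is
`a′ = 2` (clause (8)).  These configurations are charged to TERM 3 of (5.4) (p. 48), the double non-trivial
triangle `B^{(2),κ,a,2}` of App. B (Table p. 76), in the base-`u` reading of `NobleBlocksNTPrime.blockBNTpt₀'`
(DIVERGENCE D76 of the b2b-lace packet; the table as printed puts the small triangle's base at `y`), `c = 2`
summands ("`d(w,u) ≥ 2`"):

* row `(0, ≥2 | d ≥ 2)` (`w_k = u_k`): `S_{≥1,≥0,1̲,≥1}(x−t, e−t, −t, z−t) · T_{≥2,≥1,≥1}(z−t, y−t, 0)` — the square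
  `t → x → e → 0 → z` (E₂ʳ, E₁ʳ, `b_k`, the exit line `u_k → z_k`) and the triangle `t ⇒ z → y → t` (Z₁, Z₂, Xʳ);
* row `(≥2, ≥2 | d ≥ 2)`: `B_{≥1,≥1}(y−t, z−t) · P_{1̲,≥0,≥1,≥2,≥0}(e, x, t, z, v)` — the pentagon
  `0 → e → x → t ⇒ z → v` (`b_k`, E₁, E₂, Z₁, exit_kʳ) and the bubble `t → y → z` (X, Z₂ʳ)

(printed `0 = u_k`, `e = b̄_k − u_k`, `v = w_k`, `x = w_{k+1}`, `y = u_{k+1}`; LEMMAS ADDENDUM 13 §13.3,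
ADDENDUM 16 §16.2 row "(true, c = 2) | 2 | t ≠ u′", and the line accounting of the lit-g19 design note of
2026-08-19: these two rows need no bond refund).  The row `(1, ≥2 | d ≥ 2)` (a refunded `1̲` line for the start
pair) and the three `d = 1` rows (the internal bond read twice, `useTZ`) are NOT in this module.

§A the grouping `glMidP` (pentagon letter = bond + the three entry lines + exit; bubble letter = slots `3, 4`)
and the readings; §B the parameter facts; §C the cores (pentagon/bubble under `glMidP`; square/triangle under
`glMidS12` of `NobleBoundsNMidSOpen` with all five upper events); §D the cells
`nonempty_jPkg_midE_proper_two_two` / `_zero_two` (targets in absolute coordinates) and their literal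
base-`u_k` forms `…_lit` (the `c = 2` summand of `blockBNTpt₀'` rows `(2,2)` / `(0,2)` at
`(w_k−u_k, w_{k+1}−u_k, u_{k+1}−u_k, t_k−u_k, z_k−u_k)`, prefactors `δ_{v,0}(1−δ_{v,z})` included for row `0`).

Conventions: `d`-generic; nothing is cited as a fact; additive (no existing declaration is changed).
-/

noncomputable section

namespace Literature.Probability.FitznerVanDerHofstad2017

open Literature.Barriers.CriticalPhenomena Literature.Probability.Percolation
open Literature.Probability.LatticeModels Literature.Combinatorics.SimpleGraph _root_.SimpleGraph
open _root_.MeasureTheory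
open Literature.Probability.FitznerVanDerHofstad2017.NobleBlocks
open Literature.Probability.FitznerVanDerHofstad2017.NobleBlocks.LenIdx
open scoped ENNReal

variable {d : ℕ}

/-! ### A. The pentagon grouping and the readings -/

/-- The GROUPING of the `F″`-proper rows with a pentagon: letter `xb` = {bond, `up 0`, `up 1`, `up 2`, `lo 5`}
(`P_{1̲,≥0,≥1,≥2,≥0}`: `b_k`, `b̄_k → w′`, `w′ → t`, `t ⇒ z`, exit of level `k`), letter `up 3` = {`up 3`, `up 4`}
(the bubble `t → u′ → z`); lower slots all to `xb` (only `lo 5` is active at a middle junction).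
[cite: FitznerVanDerHofstad2017, App. B Table "B^{(2),ι,a,b}", row a ≥ 2, b ≥ 2, d ≥ 2 and its picture (arXiv:1506.07977v2 p. 76); §5.1 Table (p. 47)] -/
def glMidP : JIdx → JIdx
  | .xb => .xb
  | .xtz => .xtz
  | .lo _ => .xb
  | .up j => ![JIdx.xb, .xb, .xb, .up 3, .up 3, .up 5] j

section Grouping

variable (M : ℕ) (x : Site d) (b : Fin (M + 2) → Site d × Site d) (w t z : Fin (M + 2) → Site d)
  (a : Fin (M + 2) → Fin 3 ⊕ Unit) (τ : Fin (M + 1) → Bool × Fin 3)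

/-- **The grouping `glMidP` obeys the (4.65) rule over a `midE` level**: its cross-level letter joins the lower
exit line with the ENTRY slots `0, 1, 2` of level `k + 1`.
[cite: FitznerVanDerHofstad2017, §4.4 (4.65) and the sentence after it (arXiv:1506.07977v2 p. 43)] -/
theorem glMidP_entry_midE (i : Fin (M + 1)) (hσ : (τ i).1 = true) {a' : Fin 3} (ha' : a i.succ = Sum.inl a')
    (j j' : Fin 6) (hg : glMidP (.lo j) = glMidP (.up j')) :
    IsEntry (pieceViews M x b w t z a τ i.castSucc.succ).kd j' := by
  rw [pieceViews_mid_kd, ha', hσ]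
  show (j' : ℕ) < 3
  fin_cases j' <;> simp [glMidP] at hg ⊢

end Grouping

section Letter

variable (p : unitInterval) (M : ℕ) (x : Site d) (b : Fin (M + 2) → Site d × Site d) (w t z : Fin (M + 2) → Site d)
  (a : Fin (M + 2) → Fin 3 ⊕ Unit) (τ : Fin (M + 1) → Bool × Fin 3)

/-- **Five-line reading of the pentagon letter `xb`** under `glMidP`: bond (level `k`), `b̄_k → w′`, `w′ → t`,
`t ⇒ z` (level `k + 1`), exit line (level `k`).
[cite: FitznerVanDerHofstad2017, §4.2 (4.18) (arXiv:1506.07977v2 p. 35); App. B Table "B^{(2),ι,a,b}" (p. 76)] -/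
theorem junF_midEP_xb_le₅ (i i₀ : Fin (M + 1)) (hk : i₀.succ = i.castSucc) (hσ : (τ i).1 = true)
    {a₀ a' : Fin 3} (ha : a i.castSucc = Sum.inl a₀) (ha' : a i.succ = Sum.inl a')
    (EB E0 E1 E2 E3 E4 X5 : Set (BondConfig (Site d))) :
    junF p M x b w t z a τ i.castSucc glMidP true false (midEv EB E0 E1 E2 E3 E4 X5) .xb ≤
      piPerc d p 2 (genDisjOcc ![EB, E0, E1, E2, X5] ![0, 1, 1, 1, 0]) := by
  refine junF_le_of_lines p M x b w t z a τ i.castSucc glMidP true false _ JIdx.xb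
    ![JIdx.xb, .up 0, .up 1, .up 2, .lo 5] (by decide) (fun m => ?_) ![0, 1, 1, 1, 0]
    (fun m => by fin_cases m <;> rfl) ![EB, E0, E1, E2, X5] (by funext m; fin_cases m <;> rfl)
  fin_cases m
  · exact ⟨rfl, rfl⟩
  · exact ⟨(jMidE_act_up_iff M x b w t z a τ i hσ ha' true false 0).2 (by decide), rfl⟩
  · exact ⟨(jMidE_act_up_iff M x b w t z a τ i hσ ha' true false 1).2 (by decide), rfl⟩
  · exact ⟨(jMidE_act_up_iff M x b w t z a τ i hσ ha' true false 2).2 (by decide), rfl⟩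
  · exact ⟨(jMidOpen_act_lo_iff M x b w t z a τ i i₀ hk ha true false 5).2 rfl, rfl⟩

/-- **Two-line reading of the bubble letter `up 3`** under `glMidP`: `t → u′` (slot `3`), `u′ → z` (slot `4`, read
backwards). [cite: FitznerVanDerHofstad2017, §4.2 (4.16) (arXiv:1506.07977v2 p. 36); App. B (p. 76)] -/
theorem junF_midEP_up_le₂ (i : Fin (M + 1)) (hσ : (τ i).1 = true) {a' : Fin 3} (ha' : a i.succ = Sum.inl a')
    (EB E0 E1 E2 E3 E4 X5 : Set (BondConfig (Site d))) :
    junF p M x b w t z a τ i.castSucc glMidP true false (midEv EB E0 E1 E2 E3 E4 X5) (.up 3) ≤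
      piPerc d p 2 (genDisjOcc ![E3, E4] ![1, 1]) := by
  refine junF_le_of_lines p M x b w t z a τ i.castSucc glMidP true false _ (JIdx.up 3)
    ![JIdx.up 3, .up 4] (by decide) (fun m => ?_) ![1, 1] (fun m => by fin_cases m <;> rfl)
    ![E3, E4] (by funext m; fin_cases m <;> rfl)
  fin_cases m
  · exact ⟨(jMidE_act_up_iff M x b w t z a τ i hσ ha' true false 3).2 (by decide), rfl⟩
  · exact ⟨(jMidE_act_up_iff M x b w t z a τ i hσ ha' true false 4).2 (by decide), rfl⟩

/-- **Four-line reading of the square letter `xb`** under `glMidS12` in the order of the printed square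
`t → x → e → 0 → z`: `w′ → t` reversed (slot `1`), `b̄ → w′` reversed (slot `0`), bond, exit line.
[cite: FitznerVanDerHofstad2017, §4.2 (4.18) (arXiv:1506.07977v2 p. 35); App. B Table "B^{(2),ι,a,b}" row a = 0 (p. 76)] -/
theorem junF_midES_xb_le₄ (i i₀ : Fin (M + 1)) (hk : i₀.succ = i.castSucc) (hσ : (τ i).1 = true)
    {a₀ a' : Fin 3} (ha : a i.castSucc = Sum.inl a₀) (ha' : a i.succ = Sum.inl a')
    (EB E0 E1 E2 E3 E4 X5 : Set (BondConfig (Site d))) :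
    junF p M x b w t z a τ i.castSucc glMidS12 true false (midEv EB E0 E1 E2 E3 E4 X5) .xb ≤
      piPerc d p 2 (genDisjOcc ![E1, E0, EB, X5] ![1, 1, 0, 0]) := by
  refine junF_le_of_lines p M x b w t z a τ i.castSucc glMidS12 true false _ JIdx.xb
    ![JIdx.up 1, .up 0, .xb, .lo 5] (by decide) (fun m => ?_) ![1, 1, 0, 0] (fun m => by fin_cases m <;> rfl)
    ![E1, E0, EB, X5] (by funext m; fin_cases m <;> rfl)
  fin_cases m
  · exact ⟨(jMidE_act_up_iff M x b w t z a τ i hσ ha' true false 1).2 (by decide), rfl⟩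
  · exact ⟨(jMidE_act_up_iff M x b w t z a τ i hσ ha' true false 0).2 (by decide), rfl⟩
  · exact ⟨rfl, rfl⟩
  · exact ⟨(jMidOpen_act_lo_iff M x b w t z a τ i i₀ hk ha true false 5).2 rfl, rfl⟩

/-- **Three-line reading of the triangle letter `up 2`** under `glMidS12`: `t ⇒ z` (slot `2`), `z → u′` (slot `4`),
`u′ → t` (slot `3`, read backwards). [cite: FitznerVanDerHofstad2017, §4.2 (4.17) (arXiv:1506.07977v2 p. 36); App. B (p. 76)] -/
theorem junF_midES_up_le₃ (i : Fin (M + 1)) (hσ : (τ i).1 = true) {a' : Fin 3} (ha' : a i.succ = Sum.inl a')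
    (EB E0 E1 E2 E3 E4 X5 : Set (BondConfig (Site d))) :
    junF p M x b w t z a τ i.castSucc glMidS12 true false (midEv EB E0 E1 E2 E3 E4 X5) (.up 2) ≤
      piPerc d p 2 (genDisjOcc ![E2, E4, E3] ![1, 1, 1]) := by
  refine junF_le_of_lines p M x b w t z a τ i.castSucc glMidS12 true false _ (JIdx.up 2)
    ![JIdx.up 2, .up 4, .up 3] (by decide) (fun m => ?_) ![1, 1, 1] (fun m => by fin_cases m <;> rfl)
    ![E2, E4, E3] (by funext m; fin_cases m <;> rfl)
  fin_cases m
  · exact ⟨(jMidE_act_up_iff M x b w t z a τ i hσ ha' true false 2).2 (by decide), rfl⟩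
  · exact ⟨(jMidE_act_up_iff M x b w t z a τ i hσ ha' true false 4).2 (by decide), rfl⟩
  · exact ⟨(jMidE_act_up_iff M x b w t z a τ i hσ ha' true false 3).2 (by decide), rfl⟩

end Letter

/-! ### B. The parameter facts of the proper regime, inner class `2` -/

section ProperFacts

variable {M : ℕ} {x : Site d} {b : Fin (M + 2) → Site d × Site d} {w t z : Fin (M + 2) → Site d}
  {a : Fin (M + 2) → Fin 3 ⊕ Unit} {c : Fin 3 ⊕ Unit} {τ : Fin (M + 1) → Bool × Fin 3}
  {ω : Fin (M + 3) → BondConfig (Site d)} {K₀ : Fin (M + 3) → Fin 6 → Set (Sym2 (Site d))}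

/-- The PARAMETER FACTS of a non-empty `F″`-proper piece of inner class `2` at a middle junction `k = i₀ + 1`:
those of `midECut_facts` together with `t_k ≠ z_k` and the closed sausage bond.
[cite: FitznerVanDerHofstad2017, (4.58)–(4.60), (4.64) and §6.1 "Case b ≥ 2" (arXiv:1506.07977v2 pp. 41–42, 58–59)] -/
theorem midEProper_facts (hF : JFacts M x b w t z a c τ ω K₀) (i i₀ : Fin (M + 1)) (hk : i₀.succ = i.castSucc)
    (hσ : (τ i).1 = true) {a₀ a' : Fin 3} (ha : a i.castSucc = Sum.inl a₀) (ha' : a i.succ = Sum.inl a')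
    (hty : t i.castSucc ≠ (b i.succ).1) (hc2 : (τ i).2 = 2) :
    (a' = 2 ∧ z i.castSucc ≠ (b i.succ).1 ∧ w i.succ ≠ t i.castSucc ∧
      (b i.castSucc).1 ≠ t i.castSucc ∧ (b i.castSucc).1 ≠ w i.succ ∧ (b i.castSucc).1 ≠ z i.castSucc ∧
      (b i.castSucc).2 ≠ z i.castSucc ∧
      (a₀ = 0 → w i.castSucc = (b i.castSucc).1) ∧ (a₀ = 1 → (zdGraph d).Adj (b i.castSucc).1 (w i.castSucc))) ∧
    t i.castSucc ≠ z i.castSucc ∧ s(t i.castSucc, z i.castSucc) ∉ ω i.castSucc.succ :=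
  ⟨midECut_facts hF i i₀ hk hσ ha ha' hty, hF.t_ne_z_of_innerClass_ne_zero i (by rw [hc2]; decide),
    (hF.innerClass_two i hc2).2⟩

end ProperFacts

/-! ### C. The cores -/

section Packages

variable (p : unitInterval) (M : ℕ) (x : Site d) (b : Fin (M + 2) → Site d × Site d) (w t z : Fin (M + 2) → Site d)
  (a : Fin (M + 2) → Fin 3 ⊕ Unit) (c : Fin 3 ⊕ Unit) (τ : Fin (M + 1) → Bool × Fin 3)

/-- **Core, pentagon grouping**: upgraded events for all five lines of level `k + 1` and the exit line of level `k`
containing the joint witnesses, a bond event `EB ∋ {b_k}`, and bounds of the letters `xb ≤ T₁`, `up 3 ≤ T₂` give a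
package with target `T₁ * T₂`. [cite: FitznerVanDerHofstad2017, §6.1 (6.4) (arXiv:1506.07977v2 p. 58); §4.4 (4.58)–(4.60), (4.65) (pp. 41, 43)] -/
theorem nonempty_jPkg_midEP_core (i i₀ : Fin (M + 1)) (hk : i₀.succ = i.castSucc) (hσ : (τ i).1 = true)
    {a₀ a' : Fin 3} (ha : a i.castSucc = Sum.inl a₀) (ha' : a i.succ = Sum.inl a')
    (EB E0 E1 E2 E3 E4 X5 : Set (BondConfig (Site d))) (hfB : IsFinitary EB) (h0 : IsFinitary E0)
    (h1 : IsFinitary E1) (h2 : IsFinitary E2) (h3 : IsFinitary E3) (h4 : IsFinitary E4) (h5 : IsFinitary X5)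
    (hB : ({s((b i.castSucc).1, (b i.castSucc).2)} : Set (Sym2 (Site d))) ∈ EB)
    (hmem : ∀ ω K₀, JFacts M x b w t z a c τ ω K₀ →
      K₀ i.castSucc.succ 0 ∈ E0 ∧ K₀ i.castSucc.succ 1 ∈ E1 ∧ K₀ i.castSucc.succ 2 ∈ E2 ∧
        K₀ i.castSucc.succ 3 ∈ E3 ∧ K₀ i.castSucc.succ 4 ∈ E4 ∧ K₀ i.castSucc.castSucc 5 ∈ X5)
    {T₁ T₂ : ℝ≥0∞}
    (hrow₁ : junF p M x b w t z a τ i.castSucc glMidP true false (midEv EB E0 E1 E2 E3 E4 X5) .xb ≤ T₁)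
    (hrow₂ : junF p M x b w t z a τ i.castSucc glMidP true false (midEv EB E0 E1 E2 E3 E4 X5) (.up 3) ≤ T₂) :
    Nonempty (JPkg p (jctx M x b w t z a τ i.castSucc) (JFacts M x b w t z a c τ) (T₁ * T₂)) := by
  refine nonempty_jPkg_of_joint p i.castSucc glMidP true (midEv EB E0 E1 E2 E3 E4 X5)
    (isFinitary_midEv _ _ _ _ _ _ _ hfB h0 h1 h2 h3 h4 h5) (fun _ => by rw [midEv_xb]; exact hB)
    (fun j j' _ _ hg => glMidP_entry_midE M x b w t z a τ i hσ ha' j j' hg)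
    (fun ω K₀ hF => ⟨fun j hj => ?_, fun j hj => ?_⟩) ?_
  · obtain rfl := (jMidOpen_act_lo_iff M x b w t z a τ i i₀ hk ha true false j).1 hj
    rw [midEv_lo_five]
    exact (hmem ω K₀ hF).2.2.2.2.2
  · have hj5 : j ≠ 5 := (jMidE_act_up_iff M x b w t z a τ i hσ ha' true false j).1 hj
    obtain ⟨m0, m1, m2, m3, m4, -⟩ := hmem ω K₀ hF
    exact mem_midEv_up _ _ _ _ _ _ _ m0 m1 m2 m3 m4 j hj5
  · exact (prod_junF_le₂ p M x b w t z a τ i.castSucc glMidP true false _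
      (show JIdx.xb ≠ JIdx.up 3 by decide)).trans (mul_le_mul' hrow₁ hrow₂)

/-- **Core, square/triangle grouping** (`glMidS12` over a `midE` level, all five upper lines read): a package with
target `T₁ * T₂` from bounds of the letters `xb ≤ T₁`, `up 2 ≤ T₂`.
[cite: FitznerVanDerHofstad2017, §6.1 (6.4) (arXiv:1506.07977v2 p. 58); §4.4 (4.58)–(4.60), (4.65) (pp. 41, 43)] -/
theorem nonempty_jPkg_midES_core (i i₀ : Fin (M + 1)) (hk : i₀.succ = i.castSucc) (hσ : (τ i).1 = true)
    {a₀ a' : Fin 3} (ha : a i.castSucc = Sum.inl a₀) (ha' : a i.succ = Sum.inl a')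
    (EB E0 E1 E2 E3 E4 X5 : Set (BondConfig (Site d))) (hfB : IsFinitary EB) (h0 : IsFinitary E0)
    (h1 : IsFinitary E1) (h2 : IsFinitary E2) (h3 : IsFinitary E3) (h4 : IsFinitary E4) (h5 : IsFinitary X5)
    (hB : ({s((b i.castSucc).1, (b i.castSucc).2)} : Set (Sym2 (Site d))) ∈ EB)
    (hmem : ∀ ω K₀, JFacts M x b w t z a c τ ω K₀ →
      K₀ i.castSucc.succ 0 ∈ E0 ∧ K₀ i.castSucc.succ 1 ∈ E1 ∧ K₀ i.castSucc.succ 2 ∈ E2 ∧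
        K₀ i.castSucc.succ 3 ∈ E3 ∧ K₀ i.castSucc.succ 4 ∈ E4 ∧ K₀ i.castSucc.castSucc 5 ∈ X5)
    {T₁ T₂ : ℝ≥0∞}
    (hrow₁ : junF p M x b w t z a τ i.castSucc glMidS12 true false (midEv EB E0 E1 E2 E3 E4 X5) .xb ≤ T₁)
    (hrow₂ : junF p M x b w t z a τ i.castSucc glMidS12 true false (midEv EB E0 E1 E2 E3 E4 X5) (.up 2) ≤ T₂) :
    Nonempty (JPkg p (jctx M x b w t z a τ i.castSucc) (JFacts M x b w t z a c τ) (T₁ * T₂)) := by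
  refine nonempty_jPkg_of_joint p i.castSucc glMidS12 true (midEv EB E0 E1 E2 E3 E4 X5)
    (isFinitary_midEv _ _ _ _ _ _ _ hfB h0 h1 h2 h3 h4 h5) (fun _ => by rw [midEv_xb]; exact hB)
    (fun j j' _ _ hg => glMidS12_entry_midE M x b w t z a τ i hσ ha' j j' hg)
    (fun ω K₀ hF => ⟨fun j hj => ?_, fun j hj => ?_⟩) ?_
  · obtain rfl := (jMidOpen_act_lo_iff M x b w t z a τ i i₀ hk ha true false j).1 hj
    rw [midEv_lo_five]
    exact (hmem ω K₀ hF).2.2.2.2.2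
  · have hj5 : j ≠ 5 := (jMidE_act_up_iff M x b w t z a τ i hσ ha' true false j).1 hj
    obtain ⟨m0, m1, m2, m3, m4, -⟩ := hmem ω K₀ hF
    exact mem_midEv_up _ _ _ _ _ _ _ m0 m1 m2 m3 m4 j hj5
  · exact (prod_junF_le₂ p M x b w t z a τ i.castSucc glMidS12 true false _
      (show JIdx.xb ≠ JIdx.up 2 by decide)).trans (mul_le_mul' hrow₁ hrow₂)

/-! ### D. The cells -/

/-- **Row `(≥2, ≥2 | d ≥ 2)` of `B^{(2)}` at a middle junction `k = i₀ + 1`**: for `t_k ≠ u_{k+1}` (`F″`), inner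
class `2`, start class `2`, a package with target
`B_{≥1,≥1}(u_{k+1} − t_k, z_k − t_k) · P_{1̲,≥0,≥1,≥2,≥0}(b̄_k − u_k, w_{k+1} − u_k, t_k − u_k, z_k − u_k, w_k − u_k)`;
for `a′ ≤ 1` the piece is empty (clause (8)).
[cite: FitznerVanDerHofstad2017, App. B Table "B^{(2),ι,a,b}", row a ≥ 2, b ≥ 2, d_{C̃}(w,u) ≥ 2 (arXiv:1506.07977v2 p. 76); §5.1 (5.4) third term (p. 48); §4.2 (4.16)–(4.18) (pp. 35–36)] -/
theorem nonempty_jPkg_midE_proper_two_two (i i₀ : Fin (M + 1)) (hk : i₀.succ = i.castSucc) (κ : Fin d × Bool)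
    (hb : (b i.castSucc).2 = (b i.castSucc).1 + stepVec κ) (hσ : (τ i).1 = true) (hc2 : (τ i).2 = 2)
    (ha : a i.castSucc = Sum.inl 2) {a' : Fin 3} (ha' : a i.succ = Sum.inl a')
    (hty : t i.castSucc ≠ (b i.succ).1) :
    Nonempty (JPkg p (jctx M x b w t z a τ i.castSucc) (JFacts M x b w t z a c τ)
      ((Letters.perc d p).B (ge 1) (ge 1) ((b i.succ).1 - t i.castSucc) (z i.castSucc - t i.castSucc) *
        (Letters.perc d p).P (eq 1) (ge 0) (ge 1) (ge 2) (ge 0) ((b i.castSucc).2 - (b i.castSucc).1)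
          (w i.succ - (b i.castSucc).1) (t i.castSucc - (b i.castSucc).1) (z i.castSucc - (b i.castSucc).1)
          (w i.castSucc - (b i.castSucc).1))) := by
  -- exit class `a′ ≤ 1` above: the piece is empty (clause (8))
  by_cases h2 : a' = 2
  swap
  · exact nonempty_jPkg_of_sharp p c _ i hσ ha' h2 hty _
  subst h2
  -- degenerate parameters: the piece is empty
  by_cases hP : z i.castSucc ≠ (b i.succ).1 ∧ w i.succ ≠ t i.castSucc ∧ t i.castSucc ≠ z i.castSucc
  swap
  · refine ⟨JPkg.vacuous p _ _ (fun ω K₀ hF => hP ?_) _⟩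
    obtain ⟨⟨-, hzy, hwt, -⟩, htz, -⟩ := midEProper_facts hF i i₀ hk hσ ha ha' hty hc2
    exact ⟨hzy, hwt, htz⟩
  obtain ⟨hzy, hwt, htz⟩ := hP
  have huv : (b i.castSucc).1 ≠ (b i.castSucc).2 := by
    rw [hb]; exact (zdGraph_adj_iff_stepVec _ _ |>.2 ⟨κ, rfl⟩).ne
  rw [mul_comm]
  refine nonempty_jPkg_midEP_core p M x b w t z a c τ i i₀ hk hσ ha ha'
    (event (eq 1) (b i.castSucc).1 (b i.castSucc).2) (event (ge 0) (b i.castSucc).2 (w i.succ))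
    (event (ge 1) (w i.succ) (t i.castSucc)) (event (ge 2) (t i.castSucc) (z i.castSucc))
    (event (ge 1) (t i.castSucc) (b i.succ).1) (event (ge 1) (b i.succ).1 (z i.castSucc))
    (event (ge 0) (z i.castSucc) (w i.castSucc))
    (isFinitary_event _ _ _) (isFinitary_event _ _ _) (isFinitary_event _ _ _) (isFinitary_event _ _ _)
    (isFinitary_event _ _ _) (isFinitary_event _ _ _) (isFinitary_event _ _ _)
    (singleton_mem_event_eq_one huv) (fun ω K₀ hF => ?_) ?_ ?_
  · obtain ⟨h0, h1, h2, h3, h4⟩ := hF.conn_midE i hσ ha'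
    obtain ⟨-, -, hcl⟩ := midEProper_facts hF i i₀ hk hσ ha ha' hty hc2
    have h5 := hF.conn_exit i i₀ hk ha
    refine ⟨?_, ?_, ?_, ?_, ?_, ?_⟩
    · rw [event_ge]; exact mem_openConnGe_zero_of_mem h0
    · rw [event_ge]; exact mem_openConnGe_one_of_ne h1 hwt
    · rw [event_ge]
      exact mem_openConnGe_two_of_notMem h2 htz fun hm => hcl (hF.witness_subset _ 2 hm)
    · rw [event_ge]; exact mem_openConnGe_one_of_ne h3 hty
    · rw [event_comm, event_ge]; exact mem_openConnGe_one_of_ne h4 hzy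
    · rw [event_comm, event_ge]; exact mem_openConnGe_zero_of_mem h5
  · exact (junF_midEP_xb_le₅ p M x b w t z a τ i i₀ hk hσ ha ha' _ _ _ _ _ _ _).trans
      (piPerc_genDisjOcc_le_P p (eq 1) (ge 0) (ge 1) (ge 2) (ge 0) _ _ _ _ _ _ _)
  · exact (junF_midEP_up_le₂ p M x b w t z a τ i hσ ha' _ _ _ _ _ _ _).trans
      (piPerc_genDisjOcc_le_B p (ge 1) (ge 1) _ _ _ _)

/-- **Row `(≥2, ≥2 | d ≥ 2)` in the literal base-`u_k` coordinates of `NobleBlocksNTPrime.blockBNTpt₀'`** (second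
summand of `blockBNTpt₀'_two_two` at `(v,x,y,t,z) = (w_k−u_k, w_{k+1}−u_k, u_{k+1}−u_k, t_k−u_k, z_k−u_k)`):
`B_{≥1,≥1}(y−t, z−t) · P_{1̲,≥0,≥1,≥2,≥0}(e_κ, x, t, z, v)`.
[cite: FitznerVanDerHofstad2017, App. B Table "B^{(2),ι,a,b}", row a ≥ 2, b ≥ 2, d ≥ 2 (arXiv:1506.07977v2 p. 76); §5.1 (5.4) (p. 48)] -/
theorem nonempty_jPkg_midE_proper_two_two_lit (i i₀ : Fin (M + 1)) (hk : i₀.succ = i.castSucc) (κ : Fin d × Bool)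
    (hb : (b i.castSucc).2 = (b i.castSucc).1 + stepVec κ) (hσ : (τ i).1 = true) (hc2 : (τ i).2 = 2)
    (ha : a i.castSucc = Sum.inl 2) {a' : Fin 3} (ha' : a i.succ = Sum.inl a')
    (hty : t i.castSucc ≠ (b i.succ).1) :
    Nonempty (JPkg p (jctx M x b w t z a τ i.castSucc) (JFacts M x b w t z a c τ)
      ((Letters.perc d p).B (ge 1) (ge 1)
          (((b i.succ).1 - (b i.castSucc).1) - (t i.castSucc - (b i.castSucc).1))
          ((z i.castSucc - (b i.castSucc).1) - (t i.castSucc - (b i.castSucc).1)) *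
        (Letters.perc d p).P (eq 1) (ge 0) (ge 1) (ge 2) (ge 0) (stepVec κ)
          (w i.succ - (b i.castSucc).1) (t i.castSucc - (b i.castSucc).1) (z i.castSucc - (b i.castSucc).1)
          (w i.castSucc - (b i.castSucc).1))) := by
  have he : (b i.castSucc).2 - (b i.castSucc).1 = stepVec κ := by rw [hb, add_sub_cancel_left]
  rw [sub_sub_sub_cancel_right, sub_sub_sub_cancel_right, ← he]
  exact nonempty_jPkg_midE_proper_two_two p M x b w t z a c τ i i₀ hk κ hb hσ hc2 ha ha' hty

/-- **Row `(0, ≥2 | d ≥ 2)` of `B^{(2)}` at a middle junction `k = i₀ + 1`**: for `t_k ≠ u_{k+1}` (`F″`), inner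
class `2`, start class `0` (`w_k = u_k`), a package with target
`S_{≥1,≥0,1̲,≥1}(w_{k+1} − t_k, b̄_k − t_k, u_k − t_k, z_k − t_k) · T_{≥2,≥1,≥1}(z_k − t_k, u_{k+1} − t_k, 0)`; for
`a′ ≤ 1` the piece is empty (clause (8)).
[cite: FitznerVanDerHofstad2017, App. B Table "B^{(2),ι,a,b}", row a = 0, b ≥ 2, d_{C̃}(w,u) ≥ 2 (arXiv:1506.07977v2 p. 76); §5.1 (5.4) third term (p. 48); §4.2 (4.17)–(4.18) (pp. 35–36)] -/
theorem nonempty_jPkg_midE_proper_zero_two (i i₀ : Fin (M + 1)) (hk : i₀.succ = i.castSucc) (κ : Fin d × Bool)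
    (hb : (b i.castSucc).2 = (b i.castSucc).1 + stepVec κ) (hσ : (τ i).1 = true) (hc2 : (τ i).2 = 2)
    (ha : a i.castSucc = Sum.inl 0) {a' : Fin 3} (ha' : a i.succ = Sum.inl a')
    (hty : t i.castSucc ≠ (b i.succ).1) :
    Nonempty (JPkg p (jctx M x b w t z a τ i.castSucc) (JFacts M x b w t z a c τ)
      ((Letters.perc d p).S (ge 1) (ge 0) (eq 1) (ge 1) (w i.succ - t i.castSucc)
          ((b i.castSucc).2 - t i.castSucc) ((b i.castSucc).1 - t i.castSucc) (z i.castSucc - t i.castSucc) *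
        (Letters.perc d p).T (ge 2) (ge 1) (ge 1) (z i.castSucc - t i.castSucc) ((b i.succ).1 - t i.castSucc) 0)) := by
  -- exit class `a′ ≤ 1` above: the piece is empty (clause (8))
  by_cases h2 : a' = 2
  swap
  · exact nonempty_jPkg_of_sharp p c _ i hσ ha' h2 hty _
  subst h2
  -- degenerate parameters: the piece is empty
  by_cases hP : z i.castSucc ≠ (b i.succ).1 ∧ w i.succ ≠ t i.castSucc ∧ t i.castSucc ≠ z i.castSucc ∧
      (b i.castSucc).1 ≠ z i.castSucc ∧ w i.castSucc = (b i.castSucc).1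
  swap
  · refine ⟨JPkg.vacuous p _ _ (fun ω K₀ hF => hP ?_) _⟩
    obtain ⟨⟨-, hzy, hwt, -, -, huz, -, hw0, -⟩, htz, -⟩ := midEProper_facts hF i i₀ hk hσ ha ha' hty hc2
    exact ⟨hzy, hwt, htz, huz, hw0 rfl⟩
  obtain ⟨hzy, hwt, htz, huz, hwu⟩ := hP
  have huv : (b i.castSucc).1 ≠ (b i.castSucc).2 := by
    rw [hb]; exact (zdGraph_adj_iff_stepVec _ _ |>.2 ⟨κ, rfl⟩).ne
  have h := nonempty_jPkg_midES_core p M x b w t z a c τ i i₀ hk hσ ha ha'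
    (event (eq 1) (b i.castSucc).2 (b i.castSucc).1) (event (ge 0) (w i.succ) (b i.castSucc).2)
    (event (ge 1) (t i.castSucc) (w i.succ)) (event (ge 2) (t i.castSucc) (z i.castSucc))
    (event (ge 1) (b i.succ).1 (t i.castSucc)) (event (ge 1) (z i.castSucc) (b i.succ).1)
    (event (ge 1) (b i.castSucc).1 (z i.castSucc))
    (isFinitary_event _ _ _) (isFinitary_event _ _ _) (isFinitary_event _ _ _) (isFinitary_event _ _ _)
    (isFinitary_event _ _ _) (isFinitary_event _ _ _) (isFinitary_event _ _ _)
    (by rw [event_comm]; exact singleton_mem_event_eq_one huv) (fun ω K₀ hF => ?_)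
    (T₁ := (Letters.perc d p).S (ge 1) (ge 0) (eq 1) (ge 1) (w i.succ - t i.castSucc)
      ((b i.castSucc).2 - t i.castSucc) ((b i.castSucc).1 - t i.castSucc) (z i.castSucc - t i.castSucc))
    (T₂ := (Letters.perc d p).T (ge 2) (ge 1) (ge 1) (z i.castSucc - t i.castSucc) ((b i.succ).1 - t i.castSucc) 0)
    ?_ ?_
  · exact h
  · obtain ⟨h0, h1, h2, h3, h4⟩ := hF.conn_midE i hσ ha'
    obtain ⟨-, -, hcl⟩ := midEProper_facts hF i i₀ hk hσ ha ha' hty hc2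
    have h5 := hF.conn_exit i i₀ hk ha
    rw [hwu] at h5
    refine ⟨?_, ?_, ?_, ?_, ?_, ?_⟩
    · rw [event_comm, event_ge]; exact mem_openConnGe_zero_of_mem h0
    · rw [event_comm, event_ge]; exact mem_openConnGe_one_of_ne h1 hwt
    · rw [event_ge]
      exact mem_openConnGe_two_of_notMem h2 htz fun hm => hcl (hF.witness_subset _ 2 hm)
    · rw [event_comm, event_ge]; exact mem_openConnGe_one_of_ne h3 hty
    · rw [event_ge]; exact mem_openConnGe_one_of_ne h4 hzy
    · rw [event_ge]; exact mem_openConnGe_one_of_ne h5 huz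
  · exact (junF_midES_xb_le₄ p M x b w t z a τ i i₀ hk hσ ha ha' _ _ _ _ _ _ _).trans
      (piPerc_genDisjOcc_le_S p (ge 1) (ge 0) (eq 1) (ge 1) _ _ _ _ _ _)
  · refine (junF_midES_up_le₃ p M x b w t z a τ i hσ ha' _ _ _ _ _ _ _).trans ?_
    have hT := piPerc_genDisjOcc_le_T p (ge 2) (ge 1) (ge 1) (t i.castSucc) (z i.castSucc) (b i.succ).1
      (t i.castSucc) (![1, 1, 1] : Fin 3 → Fin 2)
    rwa [sub_self] at hT

/-- **Row `(0, ≥2 | d ≥ 2)` in the literal base-`u_k` coordinates of `NobleBlocksNTPrime.blockBNTpt₀'`** (second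
summand of `blockBNTpt₀'_zero_two` with its prefactors, at `(v,x,y,t,z) = (w_k−u_k, w_{k+1}−u_k, u_{k+1}−u_k,
t_k−u_k, z_k−u_k)`): `δ_{v,0} (1−δ_{v,z}) · S_{≥1,≥0,1̲,≥1}(x−t, e_κ−t, −t, z−t) · T_{≥2,≥1,≥1}(z−t, y−t, 0)`.
[cite: FitznerVanDerHofstad2017, App. B Table "B^{(2),ι,a,b}", row a = 0, b ≥ 2, d ≥ 2 (arXiv:1506.07977v2 p. 76); §5.1 (5.4) (p. 48)] -/
theorem nonempty_jPkg_midE_proper_zero_two_lit (i i₀ : Fin (M + 1)) (hk : i₀.succ = i.castSucc) (κ : Fin d × Bool)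
    (hb : (b i.castSucc).2 = (b i.castSucc).1 + stepVec κ) (hσ : (τ i).1 = true) (hc2 : (τ i).2 = 2)
    (ha : a i.castSucc = Sum.inl 0) {a' : Fin 3} (ha' : a i.succ = Sum.inl a')
    (hty : t i.castSucc ≠ (b i.succ).1) :
    Nonempty (JPkg p (jctx M x b w t z a τ i.castSucc) (JFacts M x b w t z a c τ)
      (kd (w i.castSucc - (b i.castSucc).1) 0 *
        (kdc (w i.castSucc - (b i.castSucc).1) (z i.castSucc - (b i.castSucc).1) *
          ((Letters.perc d p).S (ge 1) (ge 0) (eq 1) (ge 1)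
              ((w i.succ - (b i.castSucc).1) - (t i.castSucc - (b i.castSucc).1))
              (stepVec κ - (t i.castSucc - (b i.castSucc).1)) (-(t i.castSucc - (b i.castSucc).1))
              ((z i.castSucc - (b i.castSucc).1) - (t i.castSucc - (b i.castSucc).1)) *
            (Letters.perc d p).T (ge 2) (ge 1) (ge 1)
              ((z i.castSucc - (b i.castSucc).1) - (t i.castSucc - (b i.castSucc).1))
              (((b i.succ).1 - (b i.castSucc).1) - (t i.castSucc - (b i.castSucc).1)) 0)))) := by
  have he : (b i.castSucc).2 - (b i.castSucc).1 = stepVec κ := by rw [hb, add_sub_cancel_left]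
  -- start class `0` forces `w_k = u_k`; `u_k ≠ z_k` by vacancy: otherwise the piece is empty
  by_cases hwu : w i.castSucc = (b i.castSucc).1
  swap
  · rw [kd_of_ne (sub_ne_zero.2 hwu), zero_mul]
    exact ⟨JPkg.vacuous p _ _ (fun ω K₀ hF => hwu (hF.w_eq_of_exitClass_zero _ ha)) _⟩
  by_cases huz : (b i.castSucc).1 = z i.castSucc
  · rw [hwu, huz, kdc_self, zero_mul, mul_zero]
    refine ⟨JPkg.vacuous p _ _ (fun ω K₀ hF => ?_) _⟩
    obtain ⟨⟨-, -, -, -, -, huz', -⟩, -⟩ := midEProper_facts hF i i₀ hk hσ ha ha' hty hc2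
    exact huz' huz
  rw [hwu, sub_self, kd_self, one_mul, kdc_of_ne (fun h => huz (sub_eq_zero.1 h.symm).symm), one_mul,
    sub_sub_sub_cancel_right, sub_sub_sub_cancel_right, sub_sub_sub_cancel_right, ← he,
    sub_sub_sub_cancel_right, neg_sub]
  exact nonempty_jPkg_midE_proper_zero_two p M x b w t z a c τ i i₀ hk κ hb hσ hc2 ha ha' hty

end Packages

end Literature.Probability.FitznerVanDerHofstad2017

end
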